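import Mathlib
import Summits.NavierStokesRegularity.NavierStokesRegularity.Theorems.DssFarFieldSlavingBlowupTypeIDssProfileSimilarityEnstrophyCrossFlowThreshold
import Summits.NavierStokesRegularity.NavierStokesRegularity.Theorems.LerayQuarterDissipationFiniteDissipationLiouvilleVorticityAmplitudeTools
import Literature.Analysis.FluidPDE.VorticityCalculus
import Literature.Analysis.FluidPDE.VorticityDirectionDepletion
import HarnessLib

/-!
# Crux `FiniteDissipationLiouville` (stmt-NavierStokesRegularity-22144): the EQUALITY CASE of the
# cross-flow threshold — the «half-Beltrami» system `curl Ω = ½ U × Ω`, `‖U × Ω‖ = ‖Ω‖` has only the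
# irrotational solution on an enveloped slice

Theorems file of route `LerayQuarterDissipation` (lead prover g17; `--supports` the crux; rigidity
input for the cross-flow threshold ONE on the DSS wall, file `…CrossFlowThresholdDss`).
Navier–Stokes regularity is NOT proved by anything here; no summit is.

The tree's law-free CROSS-FLOW threshold (`…SimilarityEnstrophy.typeI_ancient_eq_zero_of_crossFlow_lt_one`,
pub-ns-dss): an enveloped KNSS-gauge Type-I field whose velocity component across the vorticity
obeys `√(−t)‖ω × u‖ ≤ θ‖ω‖` with `θ < 1` vanishes (similarity variables: `‖Ω × U‖ ≤ θ‖Ω‖`; enstrophy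
budget `½Z' = −D − ¼Z + Str`, `Str = ∫⟪U, Ω × curl Ω⟫ ≤ θ∫‖Ω‖‖curl Ω‖`, `∫‖curl Ω‖² = D`). AT the
threshold `θ = 1` the budget reads `Z' = −2∫σ` with the SLACK DENSITY
`σ = ‖curl Ω‖² + ¼‖Ω‖² − ⟪U, Ω × curl Ω⟫`, and this file analyses its equality case:

* `inner_cross_eq_inner_cross` — the scalar triple product `⟪U, Ω × C⟫ = ⟪U × Ω, C⟫`;
* `crossFlowSlack_eq` — **`σ = ‖C − ½ U×Ω‖² + ¼(‖Ω‖² − ‖U×Ω‖²)`** (pure algebra): under the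
  cross-flow hypothesis `‖Ω × U‖ ≤ ‖Ω‖` both terms are `≥ 0` (`crossFlowSlack_nonneg`), and `σ = 0`
  forces the «half-Beltrami» system `C = ½ U×Ω`, `‖U×Ω‖ = ‖Ω‖` (`eq_of_crossFlowSlack_eq_zero`);
* `eq_zero_of_norm_cross_eq_of_norm_lt_one` — `‖U×Ω‖ = ‖Ω‖` with `‖U‖ < 1` forces `Ω = 0`: on an
  ENVELOPED slice (`‖U(y)‖ ≤ A/(‖y‖+1)`) the vorticity of an equality-case slice is COMPACTLY SUPPORTED;
* **`curl_eq_zero_of_halfBeltrami_of_support`** — a `C²` field `U` on `ℝ³` with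
  `curl curl U = ½ U × curl U` and compactly supported `curl U` is IRROTATIONAL: with a cutoff `φ ≡ 1`
  on the support, `∫‖curl U‖² = ∫φ⟪curl U, curl U⟫ = ∫φ⟪U, curl curl U⟫ + (collar term vanishing on
  the support) = ½∫φ⟪U, U × curl U⟫ = 0`
  (`Literature.Analysis.FluidPDE.VorticityCalculus.integral_mul_inner_curl_eq`);
* **`lerayVorticity_slice_eq_zero_of_crossFlowSlack_eq_zero`** — on a similarity slice of a KNSS-gauge
  Type-I field with a Type-I envelope, cross-flow `≤ 1` and vanishing slack density force `Ω ≡ 0`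
  on that slice.

HONEST FRAMING. Pointwise/slice-level rigidity lemmas about a HYPOTHETICAL object; they remove
nothing from the catalogued DSS wall by themselves. Nothing here bears on Navier–Stokes regularity
or blow-up.

References: Doering–Gibbon, *Applied Analysis of the Navier–Stokes Equations* (1995) §1.4 (Lamb
form of the enstrophy production); folklore vector calculus.
-/

noncomputable section

set_option linter.dupNamespace false

namespace Summit.NavierStokesRegularity.NavierStokesRegularity.Theorems.FiniteDissipationLiouville.CrossFlow

open MeasureTheory Set Filter Topology Metric InnerProductSpace Function Real
open scoped RealInnerProductSpace ContDiff
open Literature.Analysis Literature.Analysis.FluidPDE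
open Summit.NavierStokesRegularity.NavierStokesRegularity.Theorems
open Summit.NavierStokesRegularity.NavierStokesRegularity.Theorems.GaussianGap
open Summit.NavierStokesRegularity.NavierStokesRegularity.Theorems.SimilarityEnstrophy
open Summit.NavierStokesRegularity.NavierStokesRegularity.Theorems.SmallDissipationGap
open Summit.NavierStokesRegularity.NavierStokesRegularity.Theorems.FiniteDissipationLiouville.VorticityAmplitude

/-! ### Pointwise algebra of the slack density -/

section Algebra

/-- The scalar triple product: `⟪U, Ω × C⟫ = ⟪U × Ω, C⟫`. [folklore] -/
theorem inner_cross_eq_inner_cross (U Ω C : EuclideanSpace ℝ (Fin 3)) :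
    ⟪U, cross Ω C⟫ = ⟪cross U Ω, C⟫ := by
  simp only [cross, PiLp.inner_apply, RCLike.inner_apply, conj_trivial, Fin.sum_univ_three,
    cross_apply, Matrix.cons_val_zero, Matrix.cons_val_one, Matrix.cons_val_two,
    Matrix.head_cons, Matrix.tail_cons]
  ring

/-- `‖Ω × U‖ = ‖U × Ω‖`. [folklore] -/
theorem norm_cross_comm (U Ω : EuclideanSpace ℝ (Fin 3)) : ‖cross Ω U‖ = ‖cross U Ω‖ := by
  rw [cross_eq_neg_cross_swap, norm_neg]

/-- **The slack density of the cross-flow threshold, completed square.** For all vectors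
`U, Ω, C ∈ ℝ³`:
`‖C‖² + ¼‖Ω‖² − ⟪U, Ω × C⟫ = ‖C − ½ U×Ω‖² + ¼(‖Ω‖² − ‖U×Ω‖²)`. [folklore] -/
theorem crossFlowSlack_eq (U Ω C : EuclideanSpace ℝ (Fin 3)) :
    ‖C‖ ^ 2 + (1 / 4) * ‖Ω‖ ^ 2 - ⟪U, cross Ω C⟫ =
      ‖C - (1 / 2 : ℝ) • cross U Ω‖ ^ 2 + (1 / 4) * (‖Ω‖ ^ 2 - ‖cross U Ω‖ ^ 2) := by
  rw [inner_cross_eq_inner_cross, norm_sub_sq_real, inner_smul_right, norm_smul,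
    Real.norm_of_nonneg (by norm_num : (0:ℝ) ≤ 1 / 2), real_inner_comm]
  ring

/-- Under the cross-flow hypothesis `‖Ω × U‖ ≤ ‖Ω‖` the slack density is nonnegative. [folklore] -/
theorem crossFlowSlack_nonneg {U Ω : EuclideanSpace ℝ (Fin 3)} (hX : ‖cross Ω U‖ ≤ ‖Ω‖)
    (C : EuclideanSpace ℝ (Fin 3)) :
    0 ≤ ‖C‖ ^ 2 + (1 / 4) * ‖Ω‖ ^ 2 - ⟪U, cross Ω C⟫ := by
  rw [crossFlowSlack_eq]
  rw [norm_cross_comm] at hX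
  have h2 : ‖cross U Ω‖ ^ 2 ≤ ‖Ω‖ ^ 2 := pow_le_pow_left₀ (norm_nonneg _) hX 2
  nlinarith [sq_nonneg ‖C - (1 / 2 : ℝ) • cross U Ω‖]

/-- **Equality case: the «half-Beltrami» system.** If `‖Ω × U‖ ≤ ‖Ω‖` and the slack density
vanishes, then `C = ½ U×Ω` and `‖U×Ω‖ = ‖Ω‖`. [folklore] -/
theorem eq_of_crossFlowSlack_eq_zero {U Ω C : EuclideanSpace ℝ (Fin 3)} (hX : ‖cross Ω U‖ ≤ ‖Ω‖)
    (hσ : ‖C‖ ^ 2 + (1 / 4) * ‖Ω‖ ^ 2 - ⟪U, cross Ω C⟫ = 0) :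
    C = (1 / 2 : ℝ) • cross U Ω ∧ ‖cross U Ω‖ = ‖Ω‖ := by
  rw [crossFlowSlack_eq] at hσ
  rw [norm_cross_comm] at hX
  have h2 : ‖cross U Ω‖ ^ 2 ≤ ‖Ω‖ ^ 2 := pow_le_pow_left₀ (norm_nonneg _) hX 2
  have ha : 0 ≤ ‖C - (1 / 2 : ℝ) • cross U Ω‖ ^ 2 := sq_nonneg _
  have hb : 0 ≤ (1 / 4) * (‖Ω‖ ^ 2 - ‖cross U Ω‖ ^ 2) := by linarith
  have ha0 : ‖C - (1 / 2 : ℝ) • cross U Ω‖ ^ 2 = 0 := by linarith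
  have hb0 : ‖Ω‖ ^ 2 - ‖cross U Ω‖ ^ 2 = 0 := by linarith
  refine ⟨?_, ?_⟩
  · have : ‖C - (1 / 2 : ℝ) • cross U Ω‖ = 0 := pow_eq_zero_iff (n := 2) (by norm_num) |>.1 ha0
    exact sub_eq_zero.1 (norm_eq_zero.1 this)
  · have : ‖cross U Ω‖ ^ 2 = ‖Ω‖ ^ 2 := by linarith
    exact (pow_left_inj₀ (norm_nonneg _) (norm_nonneg _) two_ne_zero).1 this

/-- **A slow velocity cannot carry unit cross-flow**: `‖U×Ω‖ = ‖Ω‖` with `‖U‖ < 1` forces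
`Ω = 0` (`‖U×Ω‖ ≤ ‖U‖‖Ω‖`). [folklore] -/
theorem eq_zero_of_norm_cross_eq_of_norm_lt_one {U Ω : EuclideanSpace ℝ (Fin 3)}
    (h : ‖cross U Ω‖ = ‖Ω‖) (hU : ‖U‖ < 1) : Ω = 0 := by
  by_contra hne
  have hpos : 0 < ‖Ω‖ := norm_pos_iff.2 hne
  have hle := norm_cross_le_norm_mul_norm U Ω
  rw [h] at hle
  nlinarith

end Algebra

/-! ### The half-Beltrami system with compactly supported vorticity is irrotational -/

section Rigidity

/-- **Rigidity of the «half-Beltrami» system.** Let `U : ℝ³ → ℝ³` be `C²` with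
`curl (curl U) = ½ U × curl U` everywhere and `curl U` supported in the closed ball of radius
`R₀ > 0`. Then `curl U ≡ 0`: against the cutoff `φ_{R₀}² ≡ 1` on the support,
`∫‖curl U‖² = ∫φ²⟪curl U, curl U⟫ = ∫φ²⟪U, curl curl U⟫ + ∫⟪U, ∇φ² × curl U⟫`
(`integral_mul_inner_curl_eq`), where the first term is `½∫φ²⟪U, U × curl U⟫ = 0` and the collar
term vanishes pointwise (`∇φ² = 0` inside the ball, `curl U = 0` outside). [folklore] -/
theorem curl_eq_zero_of_halfBeltrami_of_support
    {U : EuclideanSpace ℝ (Fin 3) → EuclideanSpace ℝ (Fin 3)} (hU : ContDiff ℝ 2 U) {R₀ : ℝ}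
    (hR₀ : 0 < R₀)
    (hcc : ∀ y, curl (curl U) y = (1 / 2 : ℝ) • cross (U y) (curl U y))
    (hsupp : ∀ y, R₀ ≤ ‖y‖ → curl U y = 0) :
    ∀ y, curl U y = 0 := by
  have hU1 : ContDiff ℝ 1 U := hU.of_le (by norm_num)
  have hΩ1 : ContDiff ℝ 1 (curl U) := contDiff_curl (n := 1) (hU.of_le (by norm_num))
  have hcΩ : Continuous (curl U) := hΩ1.continuous
  set φ : EuclideanSpace ℝ (Fin 3) → ℝ := fun z => smoothTransition (2 - ‖z‖ ^ 2 / R₀ ^ 2) ^ 2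
    with hφdef
  have hφ1 : ContDiff ℝ 1 φ := contDiff_sqCutoff (n := 1) R₀
  have hφc : HasCompactSupport φ := hasCompactSupport_sqCutoff hR₀
  have hIBP := integral_mul_inner_curl_eq (F := U) (W := curl U) hU1 hΩ1 hφ1 hφc
  -- the three pointwise identities
  have h1 : ∀ y, φ y * ⟪curl U y, curl U y⟫ = ‖curl U y‖ ^ 2 := by
    intro y
    rcases le_or_gt R₀ ‖y‖ with hy | hy
    · rw [hsupp y hy, inner_zero_left, norm_zero]; ring
    · rw [hφdef]
      dsimp only
      rw [sqCutoff_eq_one hR₀ hy.le, one_mul, real_inner_self_eq_norm_sq]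
  have h2 : ∀ y, φ y * ⟪U y, curl (curl U) y⟫ = 0 := by
    intro y
    rw [hcc y, inner_smul_right, inner_self_cross, mul_zero, mul_zero]
  have h3 : ∀ y, ⟪U y, curlCLM ((fderiv ℝ φ y).smulRight (curl U y))⟫ = 0 := by
    intro y
    rcases le_or_gt R₀ ‖y‖ with hy | hy
    · have : (fderiv ℝ φ y).smulRight (curl U y) = 0 := by
        rw [hsupp y hy]; ext v; simp
      rw [this, map_zero, inner_zero_right]
    · have : fderiv ℝ φ y = 0 := by rw [hφdef]; exact fderiv_sqCutoff_eq_zero_of_lt hR₀ hy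
      rw [this]
      have : (0 : EuclideanSpace ℝ (Fin 3) →L[ℝ] ℝ).smulRight (curl U y) = 0 := by ext v; simp
      rw [this, map_zero, inner_zero_right]
  have hE : ∫ y, ‖curl U y‖ ^ 2 = 0 := by
    have e1 : ∫ y, ‖curl U y‖ ^ 2 = ∫ y, φ y * ⟪curl U y, curl U y⟫ :=
      integral_congr_ae (Eventually.of_forall fun y => (h1 y).symm)
    rw [e1, hIBP, integral_congr_ae (Eventually.of_forall h2),
      integral_congr_ae (Eventually.of_forall h3), integral_zero, add_zero]
  -- the enstrophy density is continuous, nonnegative, compactly supported, with zero integral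
  have hsuppΩ : HasCompactSupport fun y => ‖curl U y‖ ^ 2 := by
    refine HasCompactSupport.intro (isCompact_closedBall (0 : EuclideanSpace ℝ (Fin 3)) R₀)
      fun y hy => ?_
    rw [mem_closedBall, dist_zero_right, not_le] at hy
    rw [hsupp y hy.le, norm_zero]; ring
  have hint : Integrable fun y => ‖curl U y‖ ^ 2 :=
    (hcΩ.norm.pow 2).integrable_of_hasCompactSupport hsuppΩ
  have hae : (fun y => ‖curl U y‖ ^ 2) =ᵐ[volume] 0 :=
    (integral_eq_zero_iff_of_nonneg (fun y => sq_nonneg _) hint).1 hE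
  have hev : (fun y => ‖curl U y‖ ^ 2) = fun _ => (0 : ℝ) :=
    ((hcΩ.norm.pow 2).ae_eq_iff_eq (μ := volume) continuous_const).1 hae
  intro y
  have hy := congrFun hev y
  have : ‖curl U y‖ = 0 := pow_eq_zero_iff (n := 2) (by norm_num) |>.1 hy
  exact norm_eq_zero.1 this

end Rigidity

/-! ### On a similarity slice of an enveloped Type-I field -/

section Slice

variable {C A : ℝ} {V : ℝ → EuclideanSpace ℝ (Fin 3) → EuclideanSpace ℝ (Fin 3)}

/-- **Equality case of the cross-flow threshold on an ENVELOPED slice forces zero vorticity.** Let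
`V` be a KNSS-gauge Type-I field with a Type-I envelope `HasTypeIDecay A V`, and let `s` be a
similarity time at which the cross-flow hypothesis at the threshold, `‖Ω × U‖ ≤ ‖Ω‖`, and the
vanishing of the slack density `‖curl Ω‖² + ¼‖Ω‖² − ⟪U, Ω × curl Ω⟫ = 0` hold at every point
(`U = lerayOrbit V s`, `Ω = lerayVorticity V s`). Then `Ω(s) ≡ 0`: the half-Beltrami system holds,
the envelope `‖U(y)‖ ≤ A/(‖y‖+1) < 1` for `‖y‖ ≥ max A 0 + 1` makes the vorticity compactly
supported, and `curl_eq_zero_of_halfBeltrami_of_support` applies. [folklore] -/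
theorem lerayVorticity_slice_eq_zero_of_crossFlowSlack_eq_zero (hV : IsTypeIAncientMild C V)
    (hdec : HasTypeIDecay A V) (s : ℝ)
    (hX : ∀ y, ‖cross (lerayVorticity V s y) (lerayOrbit V s y)‖ ≤ ‖lerayVorticity V s y‖)
    (hσ : ∀ y, ‖curl (lerayVorticity V s) y‖ ^ 2 + (1 / 4) * ‖lerayVorticity V s y‖ ^ 2 -
      ⟪lerayOrbit V s y, cross (lerayVorticity V s y) (curl (lerayVorticity V s) y)⟫ = 0) :
    ∀ y, lerayVorticity V s y = 0 := by
  have hU : ContDiff ℝ 2 (lerayOrbit V s) := contDiff_lerayOrbit_slice_of_typeI hV s (by norm_cast)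
  set R₀ : ℝ := max A 0 + 1 with hR₀
  have hR₀pos : 0 < R₀ := by rw [hR₀]; positivity
  have hcc : ∀ y, curl (curl (lerayOrbit V s)) y =
      (1 / 2 : ℝ) • cross (lerayOrbit V s y) (curl (lerayOrbit V s) y) := fun y =>
    (eq_of_crossFlowSlack_eq_zero (hX y) (hσ y)).1
  have hsupp : ∀ y, R₀ ≤ ‖y‖ → curl (lerayOrbit V s) y = 0 := by
    intro y hy
    have hnorm := (eq_of_crossFlowSlack_eq_zero (hX y) (hσ y)).2
    refine eq_zero_of_norm_cross_eq_of_norm_lt_one hnorm ?_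
    have hUle := hdec.norm_lerayOrbit_le s y
    have hden : 0 < ‖y‖ + 1 := by positivity
    have hA : A < ‖y‖ + 1 := by
      have : max A 0 + 1 ≤ ‖y‖ := by rwa [hR₀] at hy
      linarith [le_max_left A 0]
    exact hUle.trans_lt ((div_lt_one hden).2 hA)
  exact curl_eq_zero_of_halfBeltrami_of_support hU hR₀pos hcc hsupp

end Slice

end Summit.NavierStokesRegularity.NavierStokesRegularity.Theorems.FiniteDissipationLiouville.CrossFlow

end
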